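import Literature.Probability.RandomPlanarGeometry.SAWAllTurnUnfoldConcat
import Literature.Probability.RandomPlanarGeometry.SAWAllTurnHammersleyWelsh
import Literature.Probability.RandomPlanarGeometry.SAWBendingEnergyAllTurnWindow
import HarnessLib

/-!
# The `L` lattice: directed self-avoiding walks on the `L` orientation of `ℤ²` are the all-turn walks

Topic `Literature/Probability/RandomPlanarGeometry` (continues `SAWAllTurnUnfoldConcat.lean` — the all-turn
classes `allTurnWalksV`, `allTurnCountV`, and the step-type lemmas `turnAt_iff_types`,
`turns_eq_sub_one_iff`, `sub_eq_single_or_of_adj` — and `SAWBendingEnergyEndpoint.lean` — `allTurnCount`,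
`logMuAT`).

## What the sources print

* A. Malakis, *Self-avoiding walks on oriented square lattices*, J. Phys. A 8 (1975) 1885–1898, abstract:
  "An analysis is undertaken of the self-avoiding walk problem on two distinct oriented square lattices"
  (the Manhattan lattice and the `L` lattice); "Rigorous upper and lower bounds together with estimates are
  presented for the connective constant `μ` … for both the oriented square lattices."
* T. Kennedy, *A non-intersecting random walk on the Manhattan lattice and SLE₆*, J. Stat. Phys. (2018)
  (arXiv:1803.06728), p. 4: "a different oriented square lattice which is sometimes called the L lattice. The
  Manhattan lattice is the “covering lattice” for the L lattice in the sense of Kasteleyn … It follows the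
  orientations in the lattice, so at each step it can only turn right or left."
* A. J. Guttmann, J. Phys. A 16 (1983) 3885–3894, abstract: "The Manhattan lattice is the covering lattice
  of the L lattice".

So the `L` lattice is an orientation of the square lattice with in-degree `2` and out-degree `2` at every
site in which a directed path TURNS AT EVERY STEP: at a site the two outgoing bonds are the two bonds of one
direction type and the two incoming bonds are the two bonds of the other type, the roles alternating in a
checkerboard fashion. We fix the (unique up to a unit translation) such orientation in which the VERTICAL bonds
leave the EVEN sites (`x₀ + x₁` even) and the HORIZONTAL bonds leave the ODD sites; equivalently, horizontal
bonds point from their odd endpoint to their even endpoint and vertical bonds from their even endpoint to their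
odd endpoint (`IsLArc`).

## What is proved (namespace `Literature.Probability.RandomPlanarGeometry.SAW.Zd`)

* `IsLArc x y` — the arc relation of the `L` lattice; `lLatticeWalks N` — the `N`-step DIRECTED
  self-avoiding walks from `0` on the `L` lattice (a `Finset.filter` of the tree's `saws 2 N`).
* `even_coordSum_iff` — along any nearest-neighbour walk from `0`, the site `ω j` is even iff `j` is even.
* **`lLatticeWalks_eq_allTurnWalksV`** — for `N ≥ 1`, the directed `L`-lattice walks are EXACTLY the all-turn
  walks whose first step is vertical (`allTurnWalksV N` of `SAWAllTurnUnfoldConcat.lean`); hence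
  `card_lLatticeWalks : #lLatticeWalks N = allTurnCountV N`. With `2 · a_V(N) = a(N)` (the swap of the two
  coordinates, `allTurnSwap` of `SAWAllTurnHammersleyWelsh.lean`) this gives
  **`two_mul_card_lLatticeWalks : 2 · #lLatticeWalks N = allTurnCount N`** (`N ≥ 1`): the `L`-lattice walk count
  from a site is exactly `a(N)/2`, so the `L`-lattice connective constant `μ_L` of Malakis 1975 / Guttmann 1983 IS
  the all-turn growth constant `exp logMuAT` of `SAWBendingEnergyEndpoint.lean` (numerically `1.5657(15)`,
  Jensen–Guttmann 1998, Table 1): **`tendsto_log_card_lLatticeWalks_div : log #lLatticeWalks N / N → logMuAT`**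
  (Fekete's limit `tendsto_log_allTurnCount_div` of `SAWBendingEnergyAllTurnWindow.lean`, shifted by `log 2 / N`).

Faithfulness checks of the orientation against print (enumeration, lane pcv-sawmu, 2026-08-22): the
`L`-lattice TRAILS of this digraph reproduce `4 · A006744(n−1)` (Manhattan self-avoiding walks, Sloane–Plouffe
1995, M1073; Kennedy's covering-lattice correspondence) for `n ≤ 10`, and the directed cycles reproduce
Enting–Guttmann's (1985) `L`-lattice polygon series (Sloane–Plouffe 1995, M1930 = A006782) to length `48`.
-/

noncomputable section

open Finset Filter Topology
open Literature.Probability.LatticeModels Literature.Probability.Percolation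

namespace Literature.Probability.RandomPlanarGeometry.SAW.Zd

/-! ### The `L` orientation of `ℤ²` -/

/-- **The arcs of the `L` lattice.** `IsLArc x y`: `x ∼ y` in `ℤ²` and the step `x → y` is horizontal
(second coordinate unchanged) iff `x` is an ODD site (`x₀ + x₁` odd) — i.e. vertical bonds leave even sites,
horizontal bonds leave odd sites. This is the oriented square lattice "sometimes called the L lattice … at each
step [a directed walk] can only turn right or left".
[cite: Kennedy2018ManhattanSLE6, p. 4] [cite: Malakis1975, abstract ("two distinct oriented square lattices")] -/
def IsLArc (x y : Site 2) : Prop :=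
  (zdGraph 2).Adj x y ∧ ((y - x) 1 = 0 ↔ ¬ Even (x 0 + x 1))

open Classical in
/-- **Directed self-avoiding walks on the `L` lattice**: the `N`-step self-avoiding walks from `0` on `ℤ²`
all of whose steps are arcs of the `L` orientation (the walks counted by Malakis' `C_N` for the `L` lattice,
per starting site). [cite: Malakis1975, abstract] [cite: Kennedy2018ManhattanSLE6, p. 4] -/
def lLatticeWalks (N : ℕ) : Finset (ℕ → Site 2) :=
  (saws 2 N).filter fun ω => ∀ j, j < N → IsLArc (ω j) (ω (j + 1))

/-- `lLatticeWalks N ⊆ saws 2 N` (directed `L`-lattice walks are self-avoiding walks of `ℤ²`).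
[cite: Malakis1975, abstract] -/
theorem lLatticeWalks_subset_saws (N : ℕ) : lLatticeWalks N ⊆ saws 2 N := by
  classical
  unfold lLatticeWalks
  exact Finset.filter_subset _ _

/-! ### Step types and site parity along a walk -/

/-- A nearest-neighbour step of `ℤ²` is horizontal or vertical, not both: `(y − x)₀ = 0 ↔ (y − x)₁ ≠ 0`.
[folklore] -/
private theorem sub_apply_zero_eq_zero_iff_of_adj {x y : Site 2} (h : (zdGraph 2).Adj x y) :
    (y - x) 0 = 0 ↔ ¬ (y - x) 1 = 0 := by
  obtain ⟨i, hi | hi⟩ := sub_eq_single_or_of_adj h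
  · have h0 := congrFun hi 0
    have h1 := congrFun hi 1
    fin_cases i <;> simp at h0 h1 ⊢ <;> omega
  · have h0 := congrFun hi 0
    have h1 := congrFun hi 1
    fin_cases i <;> simp at h0 h1 ⊢ <;> omega

/-- A nearest-neighbour step of `ℤ²` flips the parity of the coordinate sum. [folklore] -/
private theorem even_coordSum_succ_iff_of_adj {x y : Site 2} (h : (zdGraph 2).Adj x y) :
    Even (y 0 + y 1) ↔ ¬ Even (x 0 + x 1) := by
  obtain ⟨i, hi | hi⟩ := sub_eq_single_or_of_adj h
  · have h0 := congrFun hi 0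
    have h1 := congrFun hi 1
    have hs : y 0 + y 1 = (x 0 + x 1) + 1 := by
      fin_cases i <;> simp at h0 h1 <;> linarith
    rw [hs, Int.even_add_one]
  · have h0 := congrFun hi 0
    have h1 := congrFun hi 1
    have hs : y 0 + y 1 = (x 0 + x 1) - 1 := by
      fin_cases i <;> simp at h0 h1 <;> linarith
    rw [hs, Int.even_sub_one]

/-- **Site parity along a walk from the origin**: for a self-avoiding walk `ω ∈ saws 2 N` and `j ≤ N`, the site
`ω j` is even (`(ω j)₀ + (ω j)₁` even) iff `j` is even (`ℤ²` is bipartite by the parity of the coordinate sum).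
[cite: MadrasSlade1993, §1.1] -/
theorem even_coordSum_iff {N : ℕ} {ω : ℕ → Site 2} (hω : ω ∈ saws 2 N) :
    ∀ j, j ≤ N → (Even (ω j 0 + ω j 1) ↔ Even j) := by
  obtain ⟨h0, -, hadj, -⟩ := mem_saws.1 hω
  intro j
  induction j with
  | zero => intro _; simp [h0]
  | succ j ih =>
    intro hj
    rw [even_coordSum_succ_iff_of_adj (hadj j (by omega)), ih (by omega), Nat.even_add_one]

/-! ### Directed `L`-lattice walks = all-turn walks with a vertical first step -/

/-- In an all-turn walk whose first step is vertical, step `j → j+1` is horizontal iff `j` is odd.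
[cite: MadrasSlade1993, §1.1] -/
theorem allTurnV_step_horizontal_iff {N : ℕ} {ω : ℕ → Site 2} (hω : ω ∈ saws 2 N)
    (hall : ∀ j, j + 2 ≤ N → turnAt N ω j) (h1 : ω 1 0 = 0) :
    ∀ j, j < N → ((ω (j + 1) - ω j) 1 = 0 ↔ Odd j) := by
  obtain ⟨h0, -, hadj, -⟩ := mem_saws.1 hω
  intro j
  induction j with
  | zero =>
    intro _
    -- the first step is vertical: `(ω 1 − ω 0)₀ = 0`, hence `(ω 1 − ω 0)₁ ≠ 0`
    have hz : (ω 1 - ω 0) 0 = 0 := by rw [Pi.sub_apply, h1, h0]; simp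
    have hv : ¬ (ω 1 - ω 0) 1 = 0 := (sub_apply_zero_eq_zero_iff_of_adj (hadj 0 (by omega))).1 hz
    have hodd : ¬ Odd 0 := by decide
    rw [Nat.zero_add]
    exact ⟨fun h => (hv h).elim, fun h => (hodd h).elim⟩
  | succ j ih =>
    intro hj
    have ht := (turnAt_iff_types hω (j := j) (by omega)).1 (hall j (by omega))
    have hprev := ih (by omega)
    rw [show j + 1 + 1 = j + 2 from rfl, Nat.odd_add_one, ← hprev]
    tauto

/-- In a directed `L`-lattice walk from `0`, step `j → j+1` is horizontal iff `j` is odd.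
[cite: Malakis1975, abstract] -/
theorem lLattice_step_horizontal_iff {N : ℕ} {ω : ℕ → Site 2} (hω : ω ∈ saws 2 N)
    (hL : ∀ j, j < N → IsLArc (ω j) (ω (j + 1))) :
    ∀ j, j < N → ((ω (j + 1) - ω j) 1 = 0 ↔ Odd j) := by
  intro j hj
  rw [(hL j hj).2, even_coordSum_iff hω j hj.le, Nat.not_even_iff_odd]

/-- **The directed self-avoiding walks on the `L` lattice are exactly the all-turn walks whose first step is
vertical** (`N ≥ 1`): following the `L` orientation from the (even) origin forces a vertical first step and a
turn at every internal vertex, and conversely an all-turn walk with a vertical first step visits even sites at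
even times and leaves them vertically, odd sites at odd times and leaves them horizontally.
[cite: Kennedy2018ManhattanSLE6, p. 4 ("at each step it can only turn right or left")] [cite: Malakis1975, abstract] -/
theorem lLatticeWalks_eq_allTurnWalksV {N : ℕ} (hN : 1 ≤ N) : lLatticeWalks N = allTurnWalksV N := by
  classical
  unfold lLatticeWalks allTurnWalksV
  refine Finset.filter_congr fun ω hω => ?_
  obtain ⟨h0, -, hadj, -⟩ := mem_saws.1 hω
  constructor
  · intro hL
    have hstep := lLattice_step_horizontal_iff hω hL
    refine ⟨(turns_eq_sub_one_iff N ω).2 fun j hj => ?_, ?_⟩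
    · rw [turnAt_iff_types hω hj, hstep j (by omega), hstep (j + 1) (by omega), Nat.odd_add_one]
      exact not_not.symm
    · -- the first step leaves the even site `0`, so it is vertical
      have hv : ¬ (ω 1 - ω 0) 1 = 0 := by rw [hstep 0 (by omega)]; simp
      have hz : (ω 1 - ω 0) 0 = 0 := (sub_apply_zero_eq_zero_iff_of_adj (hadj 0 (by omega))).2 hv
      rw [Pi.sub_apply, h0] at hz
      simpa using hz
  · rintro ⟨hturns, h1⟩
    have hall := (turns_eq_sub_one_iff N ω).1 hturns
    have hstep := allTurnV_step_horizontal_iff hω hall h1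
    intro j hj
    refine ⟨hadj j hj, ?_⟩
    rw [hstep j hj, even_coordSum_iff hω j hj.le, Nat.not_even_iff_odd]

/-- **The `L`-lattice walk count per site equals `a_V(N)`**, the number of all-turn walks with a vertical first
step (`N ≥ 1`); with the coordinate swap `2 a_V(N) = a(N)` this is `c_N(L) = a(N)/2`, so the `L`-lattice
connective constant of Malakis 1975 / Guttmann 1983 is the all-turn growth constant `exp logMuAT`.
[cite: Malakis1975, abstract] [cite: Kennedy2018ManhattanSLE6, p. 4] -/
theorem card_lLatticeWalks {N : ℕ} (hN : 1 ≤ N) : (lLatticeWalks N).card = allTurnCountV N := by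
  rw [lLatticeWalks_eq_allTurnWalksV hN]
  rfl

/-- **`2 · #(directed L-lattice walks of length N) = a(N)`** for `N ≥ 1`: by `card_lLatticeWalks` and the
coordinate-swap symmetry `2 · a_V(N) = a(N)` (`allTurnSwap`), the number of `N`-step self-avoiding walks from a
site of the `L` lattice is exactly half the number of `N`-step all-turn self-avoiding walks of `ℤ²`; in
particular the two counting sequences have the same exponential growth rate (`μ_L = μ_AT`).
[cite: Malakis1975, abstract ("two distinct oriented square lattices")]
[cite: MadrasSlade1993, §1.1 (lattice symmetries)] -/
theorem two_mul_card_lLatticeWalks {N : ℕ} (hN : 1 ≤ N) :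
    2 * (lLatticeWalks N).card = allTurnCount N := by
  rw [card_lLatticeWalks hN]
  exact allTurnSwap N hN

/-- **The `L`-lattice connective constant is `μ_AT`**: `log #lLatticeWalks N / N → log μ_AT = logMuAT`, i.e.
Malakis's `μ(L lattice) = lim_N c_N(L)^{1/N}` exists and equals the all-turn growth constant of `ℤ²`
(from `two_mul_card_lLatticeWalks` and Fekete's limit `tendsto_log_allTurnCount_div` for `a(N)`).
[cite: Malakis1975, abstract ("μ ≡ lim C_N^{1/N} … for both the oriented square lattices")]
[cite: MadrasSlade1993, §1.2, Lemma 1.2.2] -/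
theorem tendsto_log_card_lLatticeWalks_div :
    Tendsto (fun N : ℕ => Real.log ((lLatticeWalks N).card) / N) atTop (𝓝 logMuAT) := by
  have hlog2 : Tendsto (fun N : ℕ => Real.log 2 / (N : ℝ)) atTop (𝓝 0) :=
    tendsto_const_nhds.div_atTop tendsto_natCast_atTop_atTop
  have h := tendsto_log_allTurnCount_div.sub hlog2
  rw [sub_zero] at h
  refine h.congr' ?_
  filter_upwards [eventually_ge_atTop 1] with N hN
  have h2 : ((lLatticeWalks N).card : ℝ) = (allTurnCount N : ℝ) / 2 := by
    rw [eq_div_iff (two_ne_zero' ℝ), mul_comm]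
    exact_mod_cast two_mul_card_lLatticeWalks hN
  have hpos : (0 : ℝ) < allTurnCount N := by exact_mod_cast one_le_allTurnCount N
  rw [h2, Real.log_div hpos.ne' two_ne_zero, sub_div]

end Literature.Probability.RandomPlanarGeometry.SAW.Zd

end
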